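import Mathlib
import HarnessLib
import Summits.ResolutionOfSingularities.ResolutionOfSingularities.Theorems.WildQuotientsWildQuotientResolutionS1aKillCharts

/-!
# S1a — VERONESE DEGREES MULTIPLY: charts of degree `dᵢ` are charts of every common multiple, so agreeing kill charts may carry their own degrees

[OURS · L1 W4.5c · lead-1 g9; gen-8 HANDOFF «optional formal: Veronese rescaling of principal centres (to allow different degrees dᵢ in the family)»,
TWISTED-INVARIANT-DESIGN v1 §4 «a lemma principal centre (𝒦, d) ⇒ principal centre (𝒦, k·d)»] — NOT statements of the manuscript; counted 0; AI-level work,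
weaker than expert review. Crux stmt-ResolutionOfSingularities-17941, line `s1a-logminvertex` v9. Route-independent.

* `CoarseChart.veroneseNormalised_mul` — `K(d·l) = K(d)^l ∀ l` ⇒ the same for `d·k` (`k > 0`);
* `isCentreChart_mul`, `isPrincipalCentreChart_mul`, `isAdmissibleCentre_mul`, `isPrincipalCentre_mul` — the chart / centre predicates only see `d` through
  `VeroneseNormalised`, so they pass from `d` to `d·k`; `isPrincipalCentreChart_prod` — finitely many charts with degrees `dᵢ` are all charts of degree `∏ dᵢ`;
* ★ `exists_isPrincipalCentre_of_charts'` / research def `KillChartsDegReach p` (= `KillChartsReach` with PER-CHART degrees `dᵢ`) and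
  `killChartsReach_of_killChartsDegReach`: nothing in the K cut depends on a common degree.
-/

set_option linter.dupNamespace false

noncomputable section

universe u v

open CategoryTheory Limits AlgebraicGeometry TopologicalSpace Topology
open Literature.AlgebraicGeometry.Resolution Literature.AlgebraicGeometry.RelativeSpec
open Summit.ResolutionOfSingularities.ResolutionOfSingularities.Theorems.WildQuotientResolution.S1
open Summit.ResolutionOfSingularities.ResolutionOfSingularities.Theorems.WildQuotientResolution.S1.NodeAtlas
open Summit.ResolutionOfSingularities.ResolutionOfSingularities.Theorems.WildQuotientResolution.S1.KillCharts

namespace Summit.ResolutionOfSingularities.ResolutionOfSingularities.Theorems.WildQuotientResolution.S1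

/-! ## Veronese degrees multiply -/

namespace CoarseChart

variable {ι : Type v} [AddCommGroup ι] [DecidableEq ι] {B : Type u} [CommRing B]
  (𝒜 : ι → AddSubgroup B) [GradedRing 𝒜] {c : ℕ} (f : Fin c → B) (w : Fin c → ℕ)

/-- **A multiple of a Veronese degree is a Veronese degree**: `K(dkl) = K(d)^{kl} = (K(d)^k)^l = K(dk)^l`. [OURS · L1 W4.5c] -/
theorem veroneseNormalised_mul {d : ℕ} (h : VeroneseNormalised 𝒜 f w d) {k : ℕ} (hk : 0 < k) : VeroneseNormalised 𝒜 f w (d * k) := by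
  refine ⟨Nat.mul_pos h.1 hk, fun l => ?_⟩
  rw [mul_assoc, h.2 (k * l), pow_mul, ← h.2 k]

end CoarseChart

/-! ## The chart and centre predicates pass to multiples of the degree -/

namespace NodeAtlas

variable {p : ℕ} {V Y : Scheme.{u}} {q : V ⟶ Y} {G : Type*} [Group G] {ρ : ActionOver q G} {g₀ : G}

/-- `IsCentreChart` passes from `d` to `d·k`. [OURS · L1 W4.5c] -/
theorem isCentreChart_mul {𝒦 : ReesFiltration V} {d : ℕ} {O : ρ.StableAffineOpens} (h : IsCentreChart p ρ g₀ 𝒦 d O) {k : ℕ} (hk : 0 < k) :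
    IsCentreChart p ρ g₀ 𝒦 (d * k) O := by
  obtain ⟨hO, m, r, B, _, 𝒜, _, σ, e, hnode, hσ, c, f, δ, w, hc, hf, hw, hK1, hK1', hσJ, h𝒦, hver⟩ := h
  exact ⟨hO, m, r, B, inferInstance, 𝒜, inferInstance, σ, e, hnode, hσ, c, f, δ, w, hc, hf, hw, hK1, hK1', hσJ, h𝒦,
    CoarseChart.veroneseNormalised_mul 𝒜 f w hver hk⟩

/-- `IsPrincipalCentreChart` passes from `d` to `d·k` (the kill clause does not mention `d`). [OURS · L1 W4.5c] -/
theorem isPrincipalCentreChart_mul {𝒦 : ReesFiltration V} {d : ℕ} {O : ρ.StableAffineOpens} (h : IsPrincipalCentreChart p ρ g₀ 𝒦 d O) {k : ℕ}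
    (hk : 0 < k) : IsPrincipalCentreChart p ρ g₀ 𝒦 (d * k) O := by
  obtain ⟨hO, m, r, B, _, 𝒜, _, σ, e, hnode, hσ, c, f, δ, w, hc, hf, hw, hK1, hK1', hσJ, h𝒦, hver, hprin⟩ := h
  exact ⟨hO, m, r, B, inferInstance, 𝒜, inferInstance, σ, e, hnode, hσ, c, f, δ, w, hc, hf, hw, hK1, hK1', hσJ, h𝒦,
    CoarseChart.veroneseNormalised_mul 𝒜 f w hver hk, hprin⟩

/-- `IsAdmissibleCentre` passes from `d` to `d·k`. [OURS · L1 W4.5c] -/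
theorem isAdmissibleCentre_mul {𝒦 : ReesFiltration V} {d : ℕ} (h : IsAdmissibleCentre p ρ g₀ 𝒦 d) {k : ℕ} (hk : 0 < k) :
    IsAdmissibleCentre p ρ g₀ 𝒦 (d * k) :=
  ⟨Nat.mul_pos h.1 hk, h.2.1, fun v => (h.2.2 v).imp fun _ hO => ⟨hO.1, hO.2.imp_left fun hc => isCentreChart_mul hc hk⟩⟩

/-- `IsPrincipalCentre` passes from `d` to `d·k`. [OURS · L1 W4.5c] -/
theorem isPrincipalCentre_mul {𝒦 : ReesFiltration V} {d : ℕ} (h : IsPrincipalCentre p ρ g₀ 𝒦 d) {k : ℕ} (hk : 0 < k) :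
    IsPrincipalCentre p ρ g₀ 𝒦 (d * k) :=
  ⟨Nat.mul_pos h.1 hk, h.2.1, fun v => (h.2.2 v).imp fun _ hO => ⟨hO.1, hO.2.imp_left fun hc => isPrincipalCentreChart_mul hc hk⟩⟩

/-- **Finitely many principal-centre charts with degrees `dᵢ > 0` are all charts of the common degree `∏ dᵢ`.** [OURS · L1 W4.5c] -/
theorem isPrincipalCentreChart_prod {κ : Type*} [Fintype κ] {𝒦 : κ → ReesFiltration V} {d : κ → ℕ} {O : κ → ρ.StableAffineOpens}
    (hd : ∀ i, 0 < d i) (h : ∀ i, IsPrincipalCentreChart p ρ g₀ (𝒦 i) (d i) (O i)) (i : κ) :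
    IsPrincipalCentreChart p ρ g₀ (𝒦 i) (∏ j, d j) (O i) := by
  classical
  rw [← Finset.mul_prod_erase Finset.univ d (Finset.mem_univ i)]
  exact isPrincipalCentreChart_mul (h i) (Finset.prod_pos fun j _ => hd j)

end NodeAtlas

/-! ## The support of a Rees filtration does not depend on the positive degree -/

/-- `supp 𝒦_d = supp 𝒦_{d·k}` for `0 < d`, `0 < k` (both equal `supp 𝒦₁`: `𝒦₁^n ≤ 𝒦ₙ ≤ 𝒦₁`). [OURS · L1 W4.5c] -/
theorem support_ideal_eq_of_pos {V : Scheme.{u}} (𝒦 : ReesFiltration V) {d d' : ℕ} (hd : 0 < d) (hd' : 0 < d') :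
    ((𝒦.ideal d).support : Set V) = ((𝒦.ideal d').support : Set V) :=
  Set.Subset.antisymm (KillFamily.support_subset_support 𝒦 hd' d) (KillFamily.support_subset_support 𝒦 hd d')

/-! ## `KillChartsReach` with per-chart degrees -/

/-- **`KillChartsDegReach p`** (OURS CANDIDATE research statement, asserted nowhere): `KillChartsReach p` with PER-CHART Veronese degrees `dᵢ > 0` — at every
reachable all-killable model, finitely many principal-centre charts `(Oᵢ, 𝒦ᵢ, dᵢ)` agreeing on overlaps, covering the closures of their supports, one
containing a bad point. [OURS · L1 W4.5c] -/
def KillChartsDegReach (p : ℕ) : Prop :=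
  ∀ (k : Type) [Field k] [CharP k p] [PerfectField k] (X' X₁ : Scheme.{0})
    (f : X₁ ⟶ Spec (.of k)) (q : X' ⟶ X₁) (G : Type) [Group G] [Finite G]
    (ρ : G →* Aut X'), Nat.card G = p → IsSeparated f → LocallyOfFiniteType f → QuasiCompact f →
    IsIntegral X₁ → ∀ [IsIntegral X'], Scheme.IsRegular X' → IsFinite q → Function.Surjective q.base →
    (∃ U : X₁.Opens, Dense (U : Set X₁) ∧ Etale (q ∣_ U)) →
    ∀ (hq : ∀ g : G, (ρ g).hom ≫ q = q),
    (∀ x y : X', q.base x = q.base y → ∃ g : G, (ρ g).hom.base x = y) →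
    topologicalKrullDim X₁ ≤ 4 → Function.Injective ρ →
    ∀ (g₀ : G), (∀ g : G, g ∈ Subgroup.zpowers g₀) → ∀ [IsLocallyNoetherian X']
      (h₀ : NodeAtlas p (⟨ρ, hq⟩ : ActionOver q G) g₀),
      ∀ M : GameFrame.GModel p q G ρ g₀, (GameFrame.GModel.initial hq h₀).Reachable M → ¬ M.Terminal → M.jInf = ⊥ →
        ∃ (n : ℕ) (O : Fin n → M.act.StableAffineOpens) (𝒦 : Fin n → ReesFiltration M.V) (d : Fin n → ℕ), (∀ i, 0 < d i) ∧
          (∀ i, IsPrincipalCentreChart p M.act g₀ (𝒦 i) (d i) (O i)) ∧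
          (∀ i j (U : M.V.affineOpens), U.1 ≤ (O i).1 → U.1 ≤ (O j).1 →
            ∀ m, ((𝒦 i).filtration U).ideal m = ((𝒦 j).filtration U).ideal m) ∧
          (∀ i, closure ((((𝒦 i).ideal (d i)).support : Set M.V) ∩ (O i).1) ⊆ ⋃ k, ((O k).1 : Set M.V)) ∧
          ∃ i, (M.badLocus ∩ (O i).1).Nonempty

/-- **Per-chart degrees are harmless**: `KillChartsDegReach p ⇒ KillChartsReach p` (common degree `∏ dᵢ`; supports do not depend on the positive degree).
[OURS · L1 W4.5c] -/
theorem killChartsReach_of_killChartsDegReach {p : ℕ} (h : KillChartsDegReach p) : KillChartsReach p := by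
  intro k _ _ _ X' X₁ f q G _ _ ρ hG hfs hfft hfqc hX₁ _ hreg hqfin hqs hqet hq horb hdim hinj g₀ hg₀ _ h₀ M hR hT hj
  obtain ⟨n, O, 𝒦, d, hd, hprin, hagree, hcl, hbad⟩ :=
    h k X' X₁ f q G ρ hG hfs hfft hfqc hX₁ hreg hqfin hqs hqet hq horb hdim hinj g₀ hg₀ h₀ M hR hT hj
  refine ⟨n, O, 𝒦, ∏ j, d j, Finset.prod_pos fun j _ => hd j, fun i => NodeAtlas.isPrincipalCentreChart_prod hd hprin i, hagree,
    fun i => ?_, hbad⟩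
  rw [← support_ideal_eq_of_pos (𝒦 i) (hd i) (Finset.prod_pos fun j _ => hd j)]
  exact hcl i

end Summit.ResolutionOfSingularities.ResolutionOfSingularities.Theorems.WildQuotientResolution.S1

end
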